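import Literature.NumberTheory.DiophantineGeometry.HyperellipticCoordinateRingDerivation
import Mathlib.RingTheory.UniqueFactorizationDomain.Multiplicity
import HarnessLib

/-!
# Divisibility in the coordinate ring of `y² = f(x)` from the tangent derivation (Mason's order drop)

Sequel to `HyperellipticCoordinateRingDerivation` (the tangent derivation `D = 2y·∂/∂x + f′(x)·∂/∂y` of
`K[C_f] = K[X][Y]/(Y² − f)` and `ord_𝔪 (D g) = ord_𝔪 g − 1`, Mason, *Diophantine Equations over Function
Fields*, Ch. I §2 (6) [cite: Mason1984, Ch. I §2 (6)]).  We draw the divisibility consequence used for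
the ramification divisor of a rational function `t = T/U` on the smooth affine curve `C_f` (`f`
squarefree of positive degree, characteristic zero):

* `dvd_of_forall_emultiplicity_le` — in a Dedekind domain, `a ∣ b` as soon as
  `ord_𝔪 a ≤ ord_𝔪 b` at every maximal ideal (unique factorisation of ideals,
  [cite: NeukirchANT1999, Ch. I (3.3)]);
* `emultiplicity_lt_of_transversal` — the LOCAL STEP: if `g ∈ 𝔪`, `U ∉ 𝔪` and
  `2·N = U·D g − g·V`, then `ord_𝔪 N < ord_𝔪 g` (indeed `ord_𝔪 N = ord_𝔪 g − 1`: `D` lowers the order of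
  `g` by exactly one and `U` is a unit at `𝔪`);
* `dvd_prod_of_tangentDerivation` — the GLOBAL STEP: for `T U N ∈ K[C_f]` with
  `2·N = U·D T − T·D U` (so that `N/U² = D(T/U)/2` is the derivative of `t = T/U`), `N ≠ 0`, and a finite
  set `A ⊂ K` such that every maximal ideal containing `N` misses `U` and contains `T − β·U` for some
  `β ∈ A` ("every zero of `N` is a regular point of `t` with value in `A`"), one has
  **`N ∣ ∏_{β ∈ A} (T − β·U)`** in `K[C_f]`.

Written for the abc-iut cell's classical support item `GenEllTwo` ([GenEll] Thm. 2.1: the ramification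
function `N_c` of `t_c` on `D_e : s² = 1 − 4r^e` divides `∏_β (s + c·r^{k+2} − β·rs)` over the critical
values `β`), but generic.  Theorems only; no instances, no named facts.
-/

noncomputable section

open Polynomial
open scoped Polynomial.Bivariate

namespace Literature.NumberTheory.DiophantineGeometry.HyperellipticCoordinateRing

universe u

/-! ### Divisibility from orders at maximal ideals (any Dedekind domain) -/

section Dedekind

variable {R : Type*} [CommRing R] [IsDedekindDomain R]

/-- In a Dedekind domain, **`a ∣ b` for nonzero `a, b` as soon as `ord_𝔪 a ≤ ord_𝔪 b` at every maximal
ideal `𝔪`** (`ord_𝔪 x = emultiplicity 𝔪 (x)`; unique factorisation of ideals).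
[cite: NeukirchANT1999, Ch. I (3.3)] -/
theorem dvd_of_forall_emultiplicity_le {a b : R} (ha : a ≠ 0) (hb : b ≠ 0)
    (h : ∀ P : Ideal R, P.IsMaximal →
      emultiplicity P (Ideal.span {a}) ≤ emultiplicity P (Ideal.span {b})) :
    a ∣ b := by
  classical
  have ha' : Ideal.span {a} ≠ ⊥ := by rwa [Ne, Ideal.span_singleton_eq_bot]
  have hb' : Ideal.span {b} ≠ ⊥ := by rwa [Ne, Ideal.span_singleton_eq_bot]
  rw [← Ideal.span_singleton_le_span_singleton, ← Ideal.dvd_iff_le,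
    UniqueFactorizationMonoid.dvd_iff_normalizedFactors_le_normalizedFactors ha' hb',
    Multiset.le_iff_count]
  intro P
  by_cases hP : P ∈ UniqueFactorizationMonoid.normalizedFactors (Ideal.span {a})
  · have hprime : Prime P := UniqueFactorizationMonoid.prime_of_normalized_factor P hP
    have hPI : P.IsPrime := Ideal.isPrime_of_prime hprime
    have hmax : P.IsMaximal := hPI.isMaximal hprime.ne_zero
    have h1 := UniqueFactorizationMonoid.emultiplicity_eq_count_normalizedFactors
      hprime.irreducible ha'
    have h2 := UniqueFactorizationMonoid.emultiplicity_eq_count_normalizedFactors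
      hprime.irreducible hb'
    rw [normalize_eq P] at h1 h2
    have := h P hmax
    rw [h1, h2] at this
    exact_mod_cast this
  · rw [Multiset.count_eq_zero_of_notMem hP]
    exact Nat.zero_le _

/-- `ord_𝔪 x = 0 ≤ ord_𝔪 b` when `x ∉ 𝔪`. [cite: NeukirchANT1999, Ch. I (3.3)] -/
theorem emultiplicity_span_eq_zero_of_not_mem {P : Ideal R} {x : R} (hx : x ∉ P) :
    emultiplicity P (Ideal.span {x}) = 0 := by
  rw [emultiplicity_eq_zero, Ideal.dvd_span_singleton]
  exact hx

end Dedekind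

/-! ### The local step: `ord_𝔪 N < ord_𝔪 g` when `2N = U·Dg − g·V`, `g ∈ 𝔪`, `U ∉ 𝔪` -/

section Local

variable {K : Type u} [Field K] [CharZero K] {f : K[X]}

/-- **Local order comparison.** `f` squarefree of positive degree, characteristic zero, `𝔪` a maximal
ideal of `K[C_f]`, `D` the tangent derivation.  If `g ∈ 𝔪`, `g ≠ 0`, `U ∉ 𝔪` and `2·N = U·D g − g·V`,
then `ord_𝔪 N < ord_𝔪 g`: writing `ord_𝔪 g = n + 1`, `D g ∉ 𝔪^{n+1}` (transversal derivation,
`emultiplicity_tangentDerivation`), hence `U·D g ∉ 𝔪^{n+1}` while `g·V ∈ 𝔪^{n+1}`, so `2N ∉ 𝔪^{n+1}`.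
[cite: Mason1984, Ch. I §2 (6)] -/
theorem emultiplicity_lt_of_transversal (hf : Squarefree f) (hf0 : 0 < f.natDegree)
    (m : Ideal (CoordRing f)) [hm : m.IsMaximal] {g U V N : CoordRing f} (hg : g ∈ m) (hg0 : g ≠ 0)
    (hU : U ∉ m) (hN : 2 * N = U * tangentDerivation f g - g * V) :
    emultiplicity m (Ideal.span {N}) < emultiplicity m (Ideal.span {g}) := by
  haveI : IsDedekindDomain (CoordRing f) :=
    isDedekindDomain (isUnit_iff_ne_zero.mpr two_ne_zero) hf hf0
  have hmbot : m ≠ ⊥ := ne_bot_of_isMaximal hf hf0 m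
  have hfin : FiniteMultiplicity m (Ideal.span {g}) :=
    FiniteMultiplicity.of_prime_left (Ideal.prime_of_isPrime hmbot hm.isPrime)
      (by rw [Ne, Ideal.zero_eq_bot, Ideal.span_singleton_eq_bot]; exact hg0)
  -- `ord_𝔪 g = n + 1 ≥ 1`
  have h1 : (1 : ℕ) ≤ multiplicity m (Ideal.span {g}) := by
    have h := (Literature.Algebra.Derivations.mem_pow_iff_le_emultiplicity (P := m) 1 g).mp
      (by rw [pow_one]; exact hg)
    rw [hfin.emultiplicity_eq_multiplicity] at h
    exact_mod_cast h
  obtain ⟨n, hn'⟩ := Nat.exists_eq_add_of_le h1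
  have hn : emultiplicity m (Ideal.span {g}) = (n + 1 : ℕ) := by
    rw [hfin.emultiplicity_eq_multiplicity, hn', add_comm]
  -- `D g ∉ 𝔪^(n+1)`
  have hD : emultiplicity m (Ideal.span {tangentDerivation f g}) = n :=
    emultiplicity_tangentDerivation m hf hf0 hn
  have hDg : tangentDerivation f g ∉ m ^ (n + 1) := by
    intro h
    have h' := (Literature.Algebra.Derivations.mem_pow_iff_le_emultiplicity (P := m) (n + 1) _).mp h
    rw [hD] at h'
    have : n + 1 ≤ n := by exact_mod_cast h'
    omega
  -- `g ∈ 𝔪^(n+1)`, `U·D g ∉ 𝔪^(n+1)`, so `2N ∉ 𝔪^(n+1)` and `N ∉ 𝔪^(n+1)`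
  have hgn : g ∈ m ^ (n + 1) :=
    (Literature.Algebra.Derivations.mem_pow_iff_le_emultiplicity (P := m) (n + 1) g).mpr hn.ge
  have hUD : U * tangentDerivation f g ∉ m ^ (n + 1) := fun h =>
    (Ideal.IsPrime.mul_mem_pow m h).elim hU hDg
  have hNn : N ∉ m ^ (n + 1) := by
    intro h
    apply hUD
    have : U * tangentDerivation f g = 2 * N + g * V := by rw [hN]; ring
    rw [this]
    exact Ideal.add_mem _ (Ideal.mul_mem_left _ _ h) (Ideal.mul_mem_right _ _ hgn)
  rw [hn]
  by_contra hle
  rw [not_lt] at hle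
  exact hNn ((Literature.Algebra.Derivations.mem_pow_iff_le_emultiplicity (P := m) (n + 1) N).mpr hle)

end Local

/-! ### The global step: `N ∣ ∏_{β ∈ A} (T − β·U)` -/

section Linear

variable {K : Type u} [Field K] {f : K[X]}

/-- The tangent derivation is `K`-linear: `D(T − β·U) = D T − β·D U` for a scalar `β ∈ K`, hence
`U·D(T − β·U) − (T − β·U)·D U = U·D T − T·D U`. [cite: Mason1984, Ch. I §2 (6)] -/
theorem tangentDerivation_sub_smul_identity (T U : CoordRing f) (β : K) :
    U * tangentDerivation f (T - algebraMap K (CoordRing f) β * U) -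
        (T - algebraMap K (CoordRing f) β * U) * tangentDerivation f U =
      U * tangentDerivation f T - T * tangentDerivation f U := by
  rw [map_sub, Derivation.leibniz, Derivation.map_algebraMap, smul_zero, add_zero, smul_eq_mul]
  ring

end Linear

section Global

variable {K : Type u} [Field K] [CharZero K] {f : K[X]}

/-- **Mason divisibility for `t = T/U` on `C_f`.**  `f` squarefree of positive degree over a field of
characteristic zero, `D` the tangent derivation of `K[C_f]`, `T U N ∈ K[C_f]` with
`2·N = U·D T − T·D U`, `N ≠ 0`, and `A ⊂ K` finite such that every maximal ideal `𝔪 ∋ N` has `U ∉ 𝔪`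
and `T − β·U ∈ 𝔪` for some `β ∈ A` (every zero of `N` is a regular point of `t` whose value lies in
`A`), and `T − β·U ≠ 0` for `β ∈ A`.  Then **`N ∣ ∏_{β∈A} (T − β·U)`**: at each `𝔪 ∋ N`,
`ord_𝔪 N = ord_𝔪 (T − β·U) − 1 < ord_𝔪 ∏`. [cite: Mason1984, Ch. I §2 (6)] -/
theorem dvd_prod_of_tangentDerivation (hf : Squarefree f) (hf0 : 0 < f.natDegree)
    {T U N : CoordRing f} (A : Finset K)
    (hN : 2 * N = U * tangentDerivation f T - T * tangentDerivation f U) (hN0 : N ≠ 0)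
    (hmax : ∀ m : Ideal (CoordRing f), m.IsMaximal → N ∈ m →
      U ∉ m ∧ ∃ β ∈ A, T - algebraMap K (CoordRing f) β * U ∈ m)
    (hA : ∀ β ∈ A, T - algebraMap K (CoordRing f) β * U ≠ 0) :
    N ∣ ∏ β ∈ A, (T - algebraMap K (CoordRing f) β * U) := by
  haveI : IsDedekindDomain (CoordRing f) :=
    isDedekindDomain (isUnit_iff_ne_zero.mpr two_ne_zero) hf hf0
  refine dvd_of_forall_emultiplicity_le hN0 (Finset.prod_ne_zero_iff.mpr hA) fun P hP => ?_
  by_cases hNP : N ∈ P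
  · obtain ⟨hU, β, hβ, hg⟩ := hmax P hP hNP
    haveI := hP
    have key : 2 * N = U * tangentDerivation f (T - algebraMap K (CoordRing f) β * U) -
        (T - algebraMap K (CoordRing f) β * U) * tangentDerivation f U := by
      rw [tangentDerivation_sub_smul_identity, hN]
    refine (emultiplicity_lt_of_transversal hf hf0 P hg (hA β hβ) hU key).le.trans
      (emultiplicity_le_emultiplicity_of_dvd_right ?_)
    rw [Ideal.dvd_span_singleton, Ideal.mem_span_singleton]
    exact Finset.dvd_prod_of_mem _ hβ
  · rw [emultiplicity_span_eq_zero_of_not_mem hNP]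
    exact bot_le

/-- **Identity form.**  Under the hypotheses of `dvd_prod_of_tangentDerivation`, there are
`H₀, H₁ ∈ K[X]` with `∏_{β∈A} (T − β·U) = N·(H₀(x) + H₁(x)·y)` in `K[C_f]` (every element of `K[C_f]`
is `H₀(x) + H₁(x)·y`). [cite: Mason1984, Ch. I §2 (6)] -/
theorem exists_prod_eq_mul_of_tangentDerivation (hf : Squarefree f) (hf0 : 0 < f.natDegree)
    {T U N : CoordRing f} (A : Finset K)
    (hN : 2 * N = U * tangentDerivation f T - T * tangentDerivation f U) (hN0 : N ≠ 0)
    (hmax : ∀ m : Ideal (CoordRing f), m.IsMaximal → N ∈ m →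
      U ∉ m ∧ ∃ β ∈ A, T - algebraMap K (CoordRing f) β * U ∈ m)
    (hA : ∀ β ∈ A, T - algebraMap K (CoordRing f) β * U ≠ 0) :
    ∃ H₀ H₁ : K[X], ∏ β ∈ A, (T - algebraMap K (CoordRing f) β * U) =
      N * (algebraMap K[X] (CoordRing f) H₀ +
        algebraMap K[X] (CoordRing f) H₁ * AdjoinRoot.root (poly f)) := by
  obtain ⟨H, hH⟩ := dvd_prod_of_tangentDerivation hf hf0 A hN hN0 hmax hA
  obtain ⟨H₀, H₁, rfl⟩ := exists_eq_add_mul_y f H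
  exact ⟨H₀, H₁, hH⟩

end Global

/-! ### Evaluation at points of the curve -/

section Eval

variable {K : Type u} [Field K] (f : K[X]) {L : Type*} [CommRing L] [Algebra K L]

/-- A point `(r, s)` of `y² = f(x)` with coordinates in a `K`-algebra `L` (`s² = f(r)`) is a root of
`Y² − f` over the evaluation map `K[X] → L`, `X ↦ r`. [cite: Stichtenoth2009, Prop 6.2.3] -/
theorem eval₂_poly_eq_zero {r s : L} (h : s ^ 2 = aeval r f) :
    (poly f).eval₂ ((aeval r : K[X] →ₐ[K] L) : K[X] →+* L) s = 0 := by
  simp [poly, h]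

/-- **Evaluation at a point of the curve**: the ring map `K[C_f] → L`, `x ↦ r`, `y ↦ s` for
`s² = f(r)` (Mathlib `AdjoinRoot.lift`), on `y`. [cite: Stichtenoth2009, Prop 6.2.3] -/
theorem lift_root_eq {r s : L} (h : s ^ 2 = aeval r f) :
    AdjoinRoot.lift ((aeval r : K[X] →ₐ[K] L) : K[X] →+* L) s (eval₂_poly_eq_zero f h)
      (AdjoinRoot.root (poly f)) = s :=
  AdjoinRoot.lift_root _

/-- Evaluation at a point of the curve, on functions of `x`: `p(x) ↦ p(r)`.
[cite: Stichtenoth2009, Prop 6.2.3] -/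
theorem lift_algebraMap_eq {r s : L} (h : s ^ 2 = aeval r f) (p : K[X]) :
    AdjoinRoot.lift ((aeval r : K[X] →ₐ[K] L) : K[X] →+* L) s (eval₂_poly_eq_zero f h)
      (algebraMap K[X] (CoordRing f) p) = aeval r p := by
  rw [AdjoinRoot.algebraMap_eq, AdjoinRoot.lift_of]
  rfl

/-- Evaluation at a point of the curve, on constants: `β ↦ β`. [cite: Stichtenoth2009, Prop 6.2.3] -/
theorem lift_algebraMap_base_eq {r s : L} (h : s ^ 2 = aeval r f) (β : K) :
    AdjoinRoot.lift ((aeval r : K[X] →ₐ[K] L) : K[X] →+* L) s (eval₂_poly_eq_zero f h)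
      (algebraMap K (CoordRing f) β) = algebraMap K L β := by
  rw [IsScalarTower.algebraMap_apply K K[X] (CoordRing f), lift_algebraMap_eq f h,
    Polynomial.algebraMap_eq, aeval_C]

end Eval

end Literature.NumberTheory.DiophantineGeometry.HyperellipticCoordinateRing
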